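import Literature.NumberTheory.Automorphic.AdelicVectorPlaceSplittingSchwartzBruhat
import HarnessLib

/-!
# Schwartz–Bruhat functions on `X(𝔸_K) = X(K_v) × X(𝔸_K)^{(v)}`, II: the slices `𝟙_A ⊗ Φ(single t + ·)` are
# adelic test functions, and the integrated decomposition

Topic `NumberTheory/Automorphic`; namespace `Literature.NumberTheory.Automorphic.AdelicVector`.  THEOREMS ONLY
(no definition, no instance, no notation, no named fact, no `sorry`).  Sequel of ★ `AdelicVectorPlaceSplittingSchwartzBruhat`
(the finite pure-tensor decomposition `Φ(placeSplitting (a, y)) = Σ_{t ∈ T} 𝟙_{t + U}(a) · Φ(placeSplitting (t, y))` of a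
Schwartz–Bruhat function at one finite place `v`, [WeilBNT1967] Ch. VII §2, [Weil1965] n° 50):

* §4 **`indicator_evalAt_mul_slice_mem_piSchwartzBruhat`** — for `Φ ∈ 𝒮(X(𝔸_K))`, `t ∈ X(K_v)` and a compact open
  `A ⊆ X(K_v)` the pure tensor `x ↦ 𝟙_A(x_v) · Φ(single t + x^{(v)})` (`x^{(v)} = x − single x_v`) lies in
  `𝒮(X(𝔸_K)) = piSchwartzBruhat K ι` (for `Φ = Φ_∞ ⊗ Φ_f` its finite factor is
  `z ↦ 𝟙_A(z_v) Φ_f((single t)_f + z − (single z_v)_f)`, locally constant of compact support); real twin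
  `…_mem_piSchwartzBruhatReal`; the slices `y ↦ Ψ(placeSplitting (t, y))` inherit compact support, sign and
  continuity (`hasCompactSupport_slice`, `slice_nonneg`, `continuous_slice`,
  `hasCompactSupport_indicator_evalAt_mul_slice`) — this is the content of «`φ_t ∈ 𝒮(X(𝔸_K)^{(v)})`» in the
  form the consumers use (test functions `𝟙_A ⊗ φ_t` on `X(𝔸_K)`);
* §5 **`integral_eq_sum_integral_indicator_evalAt_mul_slice`** — the linearity step
  `∫ Ψ dν = Σ_{t ∈ T} ∫ 𝟙_{t + U}(x_v) · Ψ(single t + x^{(v)}) dν(x)` for `ν` finite on compact sets and compactly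
  supported `Ψ ∈ 𝒮_ℝ(X(𝔸_K))`.

USE (cell `hodgecm-mathlib`, P4 ENGINE E-2, child line `Cruxes/H413/Lines/F0_E2SiegelWeilWeilRange.lean`, stub
`stub_SW2_siegelWeil` (iii), identity road (W), ruling «TENS-v»): per slice `t`, the `φ_t`-weighted `X(K_v)`-marginals of
`μ̂_b`, `μ_b` satisfy ★ `Theorems/H413E2SWIdentityCloseCoreMarginal.measure_eq_smul_of_dilate_bound`; summing over `t`
(§5) gives `∫ Ψ dμ̂_b = κ₀ ∫ Ψ dμ_b`.  HC_CM is proved only modulo the printed citations until rung 0 closes — nothing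
here bears on a summit statement.

## References
* [WeilBNT1967] A. Weil, *Basic Number Theory* (1967), Ch. VII §2 (standard functions), Def. 1, Prop. 2.
* [Weil1965] A. Weil, *Sur la formule de Siegel dans la théorie des groupes classiques*, Acta Math. 113 (1965),
  Chap. V n° 50 (proof of Thm. 4), p. 74.
* [Bump1997] D. Bump, *Automorphic Forms and Representations* (1997), §3.3, Prop. 3.3.2.
-/

set_option autoImplicit false

noncomputable section

open MeasureTheory Set Filter Topology IsDedekindDomain NumberField
open scoped Pointwise

namespace Literature.NumberTheory.Automorphic

namespace AdelicVector

variable {K : Type} [Field K] [NumberField K] {ι : Type} [Fintype ι] {v : HeightOneSpectrum (𝓞 K)}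

/-! ## §4 The slices are adelic Schwartz–Bruhat functions -/

/-- **SLICES ARE TEST FUNCTIONS**: for `Φ ∈ 𝒮(X(𝔸_K))`, `t ∈ X(K_v)` and a compact open `A ⊆ X(K_v)` the pure
tensor `x ↦ 𝟙_A(x_v) · Φ(single t + x^{(v)})` (`x^{(v)} = x − single x_v`) lies in `𝒮(X(𝔸_K))` (for `Φ = Φ_∞ ⊗ Φ_f`
it is `Φ_∞ ⊗ (z ↦ 𝟙_A(z_v) Φ_f((single t)_f + z − (single z_v)_f))`, the finite factor locally constant of compact
support). [cite: WeilBNT1967, Ch. VII §2 Def. 1] -/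
theorem indicator_evalAt_mul_slice_mem_piSchwartzBruhat {Φ : (ι → AdeleRing (𝓞 K) K) → ℂ}
    (hΦ : Φ ∈ piSchwartzBruhat K ι) (t : ι → v.adicCompletion K) {A : Set (ι → v.adicCompletion K)}
    (hAo : IsOpen A) (hAc : IsCompact A) :
    (fun x => A.indicator (fun _ => (1 : ℂ)) (evalAt K ι v x) *
      Φ (placeSplitting K ι v (t, ((placeSplitting K ι v).symm x).2))) ∈ piSchwartzBruhat K ι := by
  classical
  simp only [placeSplitting_mk_symm_snd]
  -- the three maps on the finite side
  let E : (ι → FiniteAdeleRing (𝓞 K) K) → (ι → v.adicCompletion K) :=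
    fun z => evalAt K ι v (piAdeleSplit K ι (0, z))
  let σ : (ι → v.adicCompletion K) →+ (ι → FiniteAdeleRing (𝓞 K) K) :=
    { toFun := fun c => piFinite K ι (single K ι v c)
      map_zero' := by rw [map_zero]; rfl
      map_add' := fun c c' => by rw [map_add, piFinite_add] }
  have hE : Continuous E :=
    (continuous_evalAt K ι v).comp ((piAdeleSplit K ι).continuous.comp (Continuous.prodMk_right 0))
  have hσ : Continuous σ := (continuous_piFinite (K := K) (ι := ι)).comp (continuous_single K ι v)
  have hEx : ∀ x : ι → AdeleRing (𝓞 K) K, E (piFinite K ι x) = evalAt K ι v x :=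
    fun x => (evalAt_eq_evalAt_piAdeleSplit_piFinite x).symm
  haveI : T2Space (ι → v.adicCompletion K) := inferInstance
  have hAcl : IsClosed A := hAc.isClosed
  have h1A : IsLocallyConstant (A.indicator fun _ => (1 : ℂ)) :=
    (mem_schwartzBruhat_iff.1 (indicator_const_mem_schwartzBruhat hAo hAcl hAc 1)).1
  induction hΦ using Submodule.span_induction with
  | mem Φ hΦ =>
    obtain ⟨Φinf, Φfin, hfin, rfl⟩ := hΦ
    obtain ⟨hlc, hcs⟩ := mem_schwartzBruhat_iff.1 hfin
    -- the finite factor of the slice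
    let g : (ι → FiniteAdeleRing (𝓞 K) K) → ℂ :=
      fun z => A.indicator (fun _ => (1 : ℂ)) (E z) * Φfin (σ t + z - σ (E z))
    have hτ : Continuous fun z : ι → FiniteAdeleRing (𝓞 K) K => σ t + z - σ (E z) :=
      (continuous_const.add continuous_id).sub (hσ.comp hE)
    have hg : g ∈ SchwartzBruhat (ι → FiniteAdeleRing (𝓞 K) K) := by
      refine mem_schwartzBruhat_iff.2 ⟨(h1A.comp_continuous hE).comp₂ (hlc.comp_continuous hτ) (· * ·), ?_⟩
      -- support inside the continuous image of the compact `A × tsupport Φ_f`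
      refine (exists_compact_iff_hasCompactSupport).1
        ⟨(fun p : (ι → v.adicCompletion K) × (ι → FiniteAdeleRing (𝓞 K) K) => p.2 - σ t + σ p.1) ''
          (A ×ˢ tsupport Φfin), (hAc.prod hcs).image (by fun_prop), fun z hz => ?_⟩
      by_contra hne
      have hA : E z ∈ A := by
        by_contra h
        exact hne (by simp only [g, indicator_of_notMem h, zero_mul])
      have hw : σ t + z - σ (E z) ∈ tsupport Φfin :=
        subset_tsupport _ (Function.mem_support.2 (right_ne_zero_of_mul hne))
      exact hz ⟨(E z, σ t + z - σ (E z)), ⟨hA, hw⟩, by simp only; abel⟩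
    refine mem_piSchwartzBruhat ⟨Φinf, g, hg, funext fun x => ?_⟩
    have e1 : ∀ z, piArch K ι z = ((piAdeleSplit K ι).symm z).1 := fun z => rfl
    have e2 : ∀ z, piFinite K ι z = ((piAdeleSplit K ι).symm z).2 := fun z => rfl
    have hs : ∀ c, ((piAdeleSplit K ι).symm (single K ι v c)).1 = 0 := fun c => piArch_single c
    have h1 : piArch K ι (single K ι v t + (x - single K ι v (evalAt K ι v x))) = piArch K ι x := by
      rw [e1, map_add, map_sub, Prod.fst_add, Prod.fst_sub, hs, hs, zero_add, sub_zero, ← e1]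
    have h2 : piFinite K ι (single K ι v t + (x - single K ι v (evalAt K ι v x))) =
        σ t + piFinite K ι x - σ (E (piFinite K ι x)) := by
      rw [hEx, e2, map_add, map_sub, Prod.snd_add, Prod.snd_sub, add_sub_assoc]
      rfl
    simp only [g, h1, h2, hEx]
    ring
  | zero =>
    have h0 : (fun x : ι → AdeleRing (𝓞 K) K => A.indicator (fun _ => (1 : ℂ)) (evalAt K ι v x) *
        (0 : (ι → AdeleRing (𝓞 K) K) → ℂ) (single K ι v t + (x - single K ι v (evalAt K ι v x)))) = 0 := by
      funext x; simp only [Pi.zero_apply, mul_zero]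
    rw [h0]
    exact (piSchwartzBruhat K ι).zero_mem
  | add Φ₁ Φ₂ _ _ h₁ h₂ =>
    convert (piSchwartzBruhat K ι).add_mem h₁ h₂ using 1
    funext x; simp only [Pi.add_apply]; ring
  | smul a Φ _ h =>
    convert (piSchwartzBruhat K ι).smul_mem a h using 1
    funext x; simp only [Pi.smul_apply, smul_eq_mul]; ring

/-- **SLICES ARE TEST FUNCTIONS, REAL FORM**: `x ↦ 𝟙_A(x_v) · Ψ(single t + x^{(v)}) ∈ 𝒮_ℝ(X(𝔸_K))` for
`Ψ ∈ piSchwartzBruhatReal K ι` and compact open `A`. [cite: WeilBNT1967, Ch. VII §2 Def. 1] -/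
theorem indicator_evalAt_mul_slice_mem_piSchwartzBruhatReal {Ψ : (ι → AdeleRing (𝓞 K) K) → ℝ}
    (hΨ : Ψ ∈ piSchwartzBruhatReal K ι) (t : ι → v.adicCompletion K) {A : Set (ι → v.adicCompletion K)}
    (hAo : IsOpen A) (hAc : IsCompact A) :
    (fun x => A.indicator (fun _ => (1 : ℝ)) (evalAt K ι v x) *
      Ψ (placeSplitting K ι v (t, ((placeSplitting K ι v).symm x).2))) ∈ piSchwartzBruhatReal K ι := by
  rw [mem_piSchwartzBruhatReal_iff]
  convert indicator_evalAt_mul_slice_mem_piSchwartzBruhat (mem_piSchwartzBruhatReal_iff.1 hΨ) t hAo hAc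
    using 2 with x
  rw [Complex.ofReal_mul]
  congr 1
  by_cases h : evalAt K ι v x ∈ A
  · rw [indicator_of_mem h, indicator_of_mem h, Complex.ofReal_one]
  · rw [indicator_of_notMem h, indicator_of_notMem h, Complex.ofReal_zero]

omit [Fintype ι] in
/-- The slice `y ↦ Ψ (placeSplitting (t, y))` of a compactly supported function has compact support (`trivialAt`
is closed and `y ↦ single t + y` is a closed embedding). [cite: Bump1997, §3.3 Prop. 3.3.2] -/
theorem hasCompactSupport_slice {R : Type*} [Zero R] {Ψ : (ι → AdeleRing (𝓞 K) K) → R}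
    (hΨ : HasCompactSupport Ψ) (t : ι → v.adicCompletion K) :
    HasCompactSupport fun y : trivialAt K ι v => Ψ (placeSplitting K ι v (t, y)) := by
  have hemb : Topology.IsClosedEmbedding (Subtype.val : trivialAt K ι v → ι → AdeleRing (𝓞 K) K) :=
    (isClosed_trivialAt (K := K) (ι := ι) (v := v)).isClosedEmbedding_subtypeVal
  refine (exists_compact_iff_hasCompactSupport).1
    ⟨Subtype.val ⁻¹' ((fun x => x - single K ι v t) '' tsupport Ψ),
      hemb.isCompact_preimage (hΨ.image (continuous_id.sub continuous_const)), fun y hy => ?_⟩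
  by_contra hne
  refine hy ⟨placeSplitting K ι v (t, y), subset_tsupport _ (Function.mem_support.2 hne), ?_⟩
  simp only [placeSplitting_apply, add_sub_cancel_left]

omit [Fintype ι] in
/-- The slices of a nonnegative function are nonnegative. [cite: Bump1997, §3.3 Prop. 3.3.2] -/
theorem slice_nonneg {Ψ : (ι → AdeleRing (𝓞 K) K) → ℝ} (hΨ : 0 ≤ Ψ) (t : ι → v.adicCompletion K) :
    0 ≤ fun y : trivialAt K ι v => Ψ (placeSplitting K ι v (t, y)) :=
  fun _ => hΨ _

omit [Fintype ι] in
/-- The slices of a continuous function are continuous. [cite: Bump1997, §3.3 Prop. 3.3.2] -/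
theorem continuous_slice {R : Type*} [TopologicalSpace R] {Ψ : (ι → AdeleRing (𝓞 K) K) → R}
    (hΨ : Continuous Ψ) (t : ι → v.adicCompletion K) :
    Continuous fun y : trivialAt K ι v => Ψ (placeSplitting K ι v (t, y)) :=
  hΨ.comp ((placeSplitting K ι v).continuous.comp (Continuous.prodMk_right t))

omit [Fintype ι] in
/-- The pure tensor `x ↦ 𝟙_A(x_v) · Ψ(single t + x^{(v)})` of a compact `A` and a compactly supported `Ψ` has compact
support (inside `placeSplitting (A × slice support)`). [cite: Bump1997, §3.3 Prop. 3.3.2] -/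
theorem hasCompactSupport_indicator_evalAt_mul_slice {R : Type*} [MulZeroOneClass R]
    {Ψ : (ι → AdeleRing (𝓞 K) K) → R} (hΨ : HasCompactSupport Ψ) (t : ι → v.adicCompletion K)
    {A : Set (ι → v.adicCompletion K)} (hAc : IsCompact A) :
    HasCompactSupport fun x => A.indicator (fun _ => (1 : R)) (evalAt K ι v x) *
      Ψ (placeSplitting K ι v (t, ((placeSplitting K ι v).symm x).2)) := by
  classical
  have hK := hasCompactSupport_slice (v := v) hΨ t
  refine (exists_compact_iff_hasCompactSupport).1
    ⟨placeSplitting K ι v '' (A ×ˢ tsupport fun y : trivialAt K ι v => Ψ (placeSplitting K ι v (t, y))),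
      (hAc.prod hK).image (placeSplitting K ι v).continuous, fun x hx => ?_⟩
  by_contra hne
  have hA : evalAt K ι v x ∈ A := by
    by_contra h
    exact hne (by rw [indicator_of_notMem h, zero_mul])
  have hy : ((placeSplitting K ι v).symm x).2 ∈ tsupport fun y : trivialAt K ι v => Ψ (placeSplitting K ι v (t, y)) :=
    subset_tsupport _ (Function.mem_support.2 (right_ne_zero_of_mul hne))
  refine hx ⟨(placeSplitting K ι v).symm x, ⟨?_, hy⟩, (placeSplitting K ι v).apply_symm_apply x⟩
  rw [placeSplitting_symm_apply_fst]
  exact hA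

/-! ## §5 Integrating the decomposition -/

/-- **LINEARITY STEP**: for a measure `ν` on `X(𝔸_K)` finite on compact sets and a compactly supported
`Ψ ∈ 𝒮_ℝ(X(𝔸_K))` with decomposition data `(U, T)` as in `exists_sum_indicator_mul_slice_real`,
`∫ Ψ dν = Σ_{t ∈ T} ∫ 𝟙_{t + U}(x_v) · Ψ(single t + x^{(v)}) dν(x)` — each pure tensor is a continuous compactly
supported (indeed Schwartz–Bruhat) function, hence `ν`-integrable. [cite: Weil1965, Chap. V n° 50, p. 74] -/
theorem integral_eq_sum_integral_indicator_evalAt_mul_slice [MeasurableSpace (AdeleRing (𝓞 K) K)]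
    [BorelSpace (AdeleRing (𝓞 K) K)] (ν : Measure (ι → AdeleRing (𝓞 K) K)) [IsFiniteMeasureOnCompacts ν]
    {Ψ : (ι → AdeleRing (𝓞 K) K) → ℝ} (hΨ : Ψ ∈ piSchwartzBruhatReal K ι) (hΨc : HasCompactSupport Ψ)
    {U : AddSubgroup (ι → v.adicCompletion K)} (hUo : IsOpen (U : Set (ι → v.adicCompletion K)))
    (hUc : IsCompact (U : Set (ι → v.adicCompletion K))) {T : Finset (ι → v.adicCompletion K)}
    (hsum : ∀ x : ι → AdeleRing (𝓞 K) K, Ψ x =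
      ∑ t ∈ T, (t +ᵥ (U : Set (ι → v.adicCompletion K))).indicator (fun _ => (1 : ℝ)) (evalAt K ι v x) *
        Ψ (placeSplitting K ι v (t, ((placeSplitting K ι v).symm x).2))) :
    ∫ x, Ψ x ∂ν = ∑ t ∈ T, ∫ x, (t +ᵥ (U : Set (ι → v.adicCompletion K))).indicator (fun _ => (1 : ℝ))
      (evalAt K ι v x) * Ψ (placeSplitting K ι v (t, ((placeSplitting K ι v).symm x).2)) ∂ν := by
  haveI := secondCountableTopology_adeleRing (K := K)
  haveI : Countable ι := Finite.to_countable
  haveI : BorelSpace (ι → AdeleRing (𝓞 K) K) := Pi.borelSpace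
  rw [← integral_finsetSum]
  · exact integral_congr_ae (Filter.Eventually.of_forall hsum)
  · intro t _
    refine Continuous.integrable_of_hasCompactSupport ?_
      (hasCompactSupport_indicator_evalAt_mul_slice hΨc t ((hUc.vadd t)))
    exact continuous_of_mem_piSchwartzBruhatReal
      (indicator_evalAt_mul_slice_mem_piSchwartzBruhatReal hΨ t (hUo.vadd t) (hUc.vadd t))

end AdelicVector

end Literature.NumberTheory.Automorphic

end
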